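import Mathlib.Topology.Compactness.Lindelof
import Literature.Geometry.Lorentzian.GeodesicMaximalFlow
import Literature.Geometry.Lorentzian.LeviCivitaProofs
import Literature.Geometry.Riemannian.ExpMapLocalDiffeo
import HarnessLib

/-!
# A connected Hausdorff manifold carrying a `C¹` affine connection is σ-compact and second
# countable (Geroch 1968; Marathe 1972)

R. Geroch, *Spinor structure of space-times in general relativity. I*, J. Math. Phys. 9 (1968)
1739–1744, Appendix: a connected Hausdorff manifold admitting a Lorentz metric — indeed any affine
connection — is paracompact, equivalently second countable (K. B. Marathe, *A condition for
paracompactness of a manifold*, J. Differential Geom. 7 (1972) 571–573, for connections in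
general). This is why no countability axiom needs to be postulated for spacetimes, and it is the
step *"M̃ is second countable since it carries a Lorentzian metric"* of the constructions of the
maximal globally hyperbolic development as a union / quotient of developments
(Choquet-Bruhat–Geroch, Comm. Math. Phys. 14 (1969), proof of Thm. 3: the union of a chain of
developments; Sbierski, Ann. Henri Poincaré 17 (2016), §3.3), recorded as missing in
`Literature.Geometry.Lorentzian.CauchyProblemMGHDExistenceProofs` (§ "What remains", item (a)).
Unlike the auxiliary-Riemannian-metric argument, the proof below needs NO time orientation — the
glued spacetimes of those constructions do not come with a timelike vector field before they are
known to be paracompact.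

Setting: a Hausdorff `C^∞` manifold `M` without boundary over a model with corners `I` on a
finite-dimensional real space `E` (model space `H`), and a bundled covariant derivative `cov` on
`TM` of class `C¹` (Mathlib's `ContMDiffCovariantDerivative cov 1`; e.g. the Levi-Civita
connection of a `C^∞` pseudo-Riemannian metric), with the tree's maximal geodesics
`γ_p = maximalGeodesic cov p.proj p.2`, `dom γ_p = maximalGeodesicDomain cov …`
(`Literature.Geometry.Riemannian.ExponentialMap`), the continuity of the geodesic flow on its open
domain (`Literature.Geometry.Lorentzian.isOpen_continuousOn_maximalGeodesic`,
`GeodesicMaximalFlow`), its flow property (`maximalGeodesicDomain_tangentLift_eq`) and the local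
diffeomorphism property of `exp_x` at `0`
(`Literature.Geometry.Riemannian.isLocalDiffeomorphAt_expMap_zero_of_le`, `ExpMapLocalDiffeo`).

Proof ("geodesic sweeps"). Call the *geodesic sweep* of `A ⊆ M` the set of points `γ_p(t)` with
`π p ∈ A`, `t ∈ dom γ_p`.
* `isLindelof_geodesicSweep_chartSource` — the sweep of a chart domain is Lindelöf: it is the image
  under the (continuous) geodesic flow of a subset of `π⁻¹(chart domain) × ℝ`, which a partial
  homeomorphism (tangent trivialization, chart, identity) maps into the second countable space
  `(H × E) × ℝ`;
* `exists_nhds_geodesic_reach` — every point `q` has a neighbourhood `V` all of whose points are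
  joined to `q` by a geodesic segment in both directions (`exp_q` is a local diffeomorphism at `0`,
  and the flow property reverses the segment);
* `mem_iUnion_iterate_geodesicSweep` — on a connected manifold every point is reached from a base
  point `x₀` by a broken geodesic: the set of points swept in finitely many steps from `{x₀}` is
  open and closed;
* `isLindelof_univ_of_covariantDerivative` — hence `M` is a countable union of Lindelöf sets
  (by induction each finite sweep of `{x₀}` lies in a countable union of sweeps of chart domains);
* `sigmaCompactSpace_of_covariantDerivative`, `secondCountableTopology_of_covariantDerivative` —
  Lindelöf and weakly locally compact spaces are σ-compact (`sigmaCompactSpace_of_lindelof`), and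
  σ-compact charted spaces over a second countable model are second countable
  (`ChartedSpace.secondCountable_of_sigmaCompact`);
* `PseudoRiemannianMetric.secondCountableTopology_of_two_le` — the metric form: a connected
  Hausdorff manifold with a `C^n` pseudo-Riemannian metric, `n ≥ 2`, is second countable (its
  Levi-Civita connection is `C¹`, `isLocallyContMDiff_leviCivita_holds`), and
  `LorentzianMetric.secondCountableTopology_euclidean` — **every connected Hausdorff `C^∞` manifold
  modelled on `ℝᵈ` with a smooth Lorentzian metric is second countable**: the countability field
  of `LorentzianManifold` / `Spacetime` follows from the others (Geroch's theorem as used by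
  Choquet-Bruhat–Geroch and Sbierski).

All results proved; no definitions, no named facts.

## References

* R. Geroch, J. Math. Phys. 9 (1968) 1739–1744, Appendix. [Geroch1968JMP]
* K. B. Marathe, J. Differential Geom. 7 (1972) 571–573.
* J. Sbierski, Ann. Henri Poincaré 17 (2016) 301–329 = arXiv:1309.7591, §3.3. [Sbierski2016AHP]
* J. M. Lee, *Introduction to Riemannian Manifolds*, 2nd ed. (2018), Prop. 5.19, Cor. 4.28.
  [LeeRiemannianManifolds2018]
-/

noncomputable section

open Bundle Set Filter Function TopologicalSpace Topology
open scoped Manifold ContDiff Topology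

namespace Literature.Geometry.Manifold

open Literature.Geometry.Lorentzian Literature.Geometry.Riemannian

variable {E : Type*} [NormedAddCommGroup E] [NormedSpace ℝ E] {H : Type*} [TopologicalSpace H]
  {I : ModelWithCorners ℝ E H} {M : Type*} [TopologicalSpace M] [ChartedSpace H M]
  [IsManifold I ∞ M] [FiniteDimensional ℝ E]
  {cov : CovariantDerivative I E (TangentSpace I : M → Type _)}
  [CompleteSpace E] [T2Space M] [BoundarylessManifold I M]
  [CovariantDerivative.ContMDiffCovariantDerivative cov 1]

/-! ### Lindelöf + weakly locally compact ⇒ σ-compact -/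

omit [T2Space M] [ChartedSpace H M] in
/-- A Lindelöf, weakly locally compact space is σ-compact (cover by compact neighbourhoods and
extract a countable subcover; cf. Mathlib's `sigmaCompactSpace_of_locallyCompact_secondCountable`).
[folklore] -/
theorem sigmaCompactSpace_of_lindelof (X : Type*) [TopologicalSpace X] [WeaklyLocallyCompactSpace X]
    [LindelofSpace X] : SigmaCompactSpace X := by
  choose K hKc hxK using fun x : X ↦ exists_compact_mem_nhds x
  rcases countable_cover_nhds hxK with ⟨s, hsc, hsU⟩
  refine SigmaCompactSpace.of_countable _ (hsc.image K) (forall_mem_image.2 fun x _ ↦ hKc x) ?_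
  rwa [sUnion_image]

/-! ### Geodesic sweeps of chart domains are Lindelöf -/

variable (cov) in
/-- **The geodesic sweep of a chart domain is Lindelöf**: the set of points `γ_p(t)`, `p ∈ TM` over
the chart domain of `x₀`, `t ∈ dom γ_p`, is Lindelöf — it is the image under the geodesic flow
(continuous on its open domain, `isOpen_continuousOn_maximalGeodesic`) of a subset of
`π⁻¹(U) × ℝ`, and the tangent trivialization at `x₀` followed by the chart is a partial
homeomorphism of `TM × ℝ` into the second countable (hence hereditarily Lindelöf) space
`(H × E) × ℝ` whose source contains `π⁻¹(U) × ℝ`. [cite: Geroch1968JMP, Appendix] -/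
theorem isLindelof_geodesicSweep_chartSource [SecondCountableTopology H] (x₀ : M) :
    IsLindelof {q : M | ∃ p : TangentBundle I M, p.proj ∈ (chartAt H x₀).source ∧
      ∃ t ∈ maximalGeodesicDomain cov p.proj p.2, maximalGeodesic cov p.proj p.2 t = q} := by
  obtain ⟨-, hF⟩ := isOpen_continuousOn_maximalGeodesic (cov := cov) (I := I) (M := M)
  set S : Set (TangentBundle I M × ℝ) := {q | q.1.proj ∈ (chartAt H x₀).source ∧
    q.2 ∈ maximalGeodesicDomain cov q.1.proj q.1.2} with hS
  -- the partial homeomorphism `TM × ℝ → (H × E) × ℝ`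
  set e := trivializationAt E (TangentSpace I : M → Type _) x₀ with he
  set Ψ : OpenPartialHomeomorph (TangentBundle I M × ℝ) ((H × E) × ℝ) :=
    (e.toOpenPartialHomeomorph.trans ((chartAt H x₀).prod (OpenPartialHomeomorph.refl E))).prod
      (OpenPartialHomeomorph.refl ℝ) with hΨ
  have hSΨ : S ⊆ Ψ.source := by
    rintro ⟨p, t⟩ ⟨hp, -⟩
    have hpe : p ∈ e.source := by
      rw [e.mem_source, he, TangentBundle.trivializationAt_baseSet]
      exact hp
    rw [hΨ, OpenPartialHomeomorph.prod_source, OpenPartialHomeomorph.refl_source, mem_prod]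
    refine ⟨?_, mem_univ _⟩
    rw [OpenPartialHomeomorph.trans_source, mem_inter_iff, mem_preimage,
      OpenPartialHomeomorph.prod_source, OpenPartialHomeomorph.refl_source, mem_prod,
      Trivialization.coe_coe, e.coe_fst hpe]
    exact ⟨hpe, hp, mem_univ _⟩
  have hSl : IsLindelof S := by
    have h1 : IsLindelof (Ψ '' S) := HereditarilyLindelofSpace.isLindelof _
    rw [← Ψ.symm_image_image_of_subset_source hSΨ]
    refine h1.image_of_continuousOn (Ψ.continuousOn_symm.mono ?_)
    rw [← Ψ.image_source_eq_target]
    exact image_mono hSΨ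
  have himage : {q : M | ∃ p : TangentBundle I M, p.proj ∈ (chartAt H x₀).source ∧
      ∃ t ∈ maximalGeodesicDomain cov p.proj p.2, maximalGeodesic cov p.proj p.2 t = q} =
      (fun q : TangentBundle I M × ℝ ↦ maximalGeodesic cov q.1.proj q.1.2 q.2) '' S := by
    ext q
    simp only [mem_setOf_eq, mem_image, hS, Prod.exists]
    constructor
    · rintro ⟨p, hp, t, ht, rfl⟩
      exact ⟨p, t, ⟨hp, ht⟩, rfl⟩
    · rintro ⟨p, t, ⟨hp, ht⟩, rfl⟩
      exact ⟨p, hp, t, ht, rfl⟩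
  rw [himage]
  exact hSl.image_of_continuousOn (hF.mono fun q hq ↦ hq.2)

/-! ### Local reachability by geodesic segments -/

variable (cov) in
/-- **Every point has a neighbourhood of geodesically reachable points, in both directions**: there
is `V ∈ 𝓝 q` such that every `q' ∈ V` is `γ_p(t)` for some `p ∈ T_q M`, `t ∈ dom γ_p`, and `q` is
`γ_{p'}(t')` for some `p' ∈ T_{q'} M`, `t' ∈ dom γ_{p'}`. Indeed `exp_q` is a local diffeomorphism
at `0` (`isLocalDiffeomorphAt_expMap_zero_of_le`), so a neighbourhood of `q` consists of points
`exp_q(v) = γ_v(1)`; and by the flow property (`maximalGeodesicDomain_tangentLift_eq`) the maximal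
geodesic issuing from `(γ_v(1), γ_v'(1))` is `u ↦ γ_v(u + 1)`, which returns to `q` at `u = -1`.
[cite: LeeRiemannianManifolds2018, Prop. 5.19 (d)] -/
theorem exists_nhds_geodesic_reach (q : M) : ∃ V ∈ 𝓝 q, ∀ q' ∈ V,
    (∃ p : TangentBundle I M, p.proj = q ∧
      ∃ t ∈ maximalGeodesicDomain cov p.proj p.2, maximalGeodesic cov p.proj p.2 t = q') ∧
    (∃ p : TangentBundle I M, p.proj = q' ∧
      ∃ t ∈ maximalGeodesicDomain cov p.proj p.2, maximalGeodesic cov p.proj p.2 t = q) := by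
  obtain ⟨Φ, h0, heq⟩ :=
    isLocalDiffeomorphAt_expMap_zero_of_le (cov := cov) (k := (1 : ℕ∞)) le_rfl q
  set W : Set E := Φ.source ∩ {v : E | (show TangentSpace I q from v) ∈ expDomain cov q} with hW
  have hWo : IsOpen W :=
    Φ.open_source.inter (isOpen_expDomain (cov := cov) (k := (1 : ℕ∞)) le_rfl q)
  have h0W : (0 : E) ∈ W := ⟨h0, zero_mem_expDomain (cov := cov) q⟩
  have hWs : W ⊆ Φ.source := inter_subset_left
  refine ⟨Φ '' W, ?_, fun q' hq' ↦ ?_⟩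
  · refine (Φ.toOpenPartialHomeomorph.isOpen_image_of_subset_source hWo hWs).mem_nhds ?_
    refine ⟨0, h0W, ?_⟩
    have h := heq h0
    simp only at h
    exact (h.symm.trans (expMap_zero (cov := cov) q) : _)
  obtain ⟨v, hvW, rfl⟩ := hq'
  have hexp : Φ v = maximalGeodesic cov q (show TangentSpace I q from v) 1 := by
    have h := heq (hWs hvW)
    simp only at h
    exact h.symm.trans (expMap_of_mem hvW.2)
  have h1 : (1 : ℝ) ∈ maximalGeodesicDomain cov q (show TangentSpace I q from v) := hvW.2.2
  set p : TangentBundle I M := ⟨q, v⟩ with hp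
  refine ⟨⟨p, rfl, 1, h1, hexp.symm⟩, ?_⟩
  -- reverse the segment with the flow property
  obtain ⟨hdom, hEq⟩ := maximalGeodesicDomain_tangentLift_eq (cov := cov) p (s := 1) h1
  obtain ⟨-, h0dom, hγ0, -⟩ := maximalGeodesic_spec (hasMaximalGeodesic (cov := cov) q
    (show TangentSpace I q from v))
  have hmem : (-1 : ℝ) ∈ {t : ℝ | t + 1 ∈ maximalGeodesicDomain cov p.proj p.2} := by
    show (-1 : ℝ) + 1 ∈ maximalGeodesicDomain cov q (show TangentSpace I q from v)
    rw [neg_add_cancel]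
    exact h0dom
  refine ⟨tangentLift I (maximalGeodesic cov p.proj p.2) 1, ?_, -1, hdom ▸ hmem, ?_⟩
  · show maximalGeodesic cov q (show TangentSpace I q from v) 1 = Φ v
    exact hexp.symm
  · rw [← hEq hmem]
    show maximalGeodesic cov q (show TangentSpace I q from v) (-1 + 1) = q
    rw [neg_add_cancel]
    exact hγ0

/-! ### Global reachability by broken geodesics -/

variable (cov) in
/-- **On a connected manifold every point is reached from `x₀` by a broken geodesic**: writing
`sweep A` for the set of points `γ_p(t)` with `π p ∈ A`, `t ∈ dom γ_p`, every `q` lies in some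
finite iterate `sweep^[k] {x₀}`. The union of the iterates is open and closed by
`exists_nhds_geodesic_reach` (forward reachability gives openness, backward reachability
closedness) and contains `x₀`. [cite: Geroch1968JMP, Appendix] -/
theorem mem_iUnion_iterate_geodesicSweep [PreconnectedSpace M] (x₀ q : M) :
    ∃ k : ℕ, q ∈ (fun A : Set M ↦ {q : M | ∃ p : TangentBundle I M, p.proj ∈ A ∧
      ∃ t ∈ maximalGeodesicDomain cov p.proj p.2, maximalGeodesic cov p.proj p.2 t = q})^[k]
        {x₀} := by
  set sw : Set M → Set M := fun A ↦ {q : M | ∃ p : TangentBundle I M, p.proj ∈ A ∧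
      ∃ t ∈ maximalGeodesicDomain cov p.proj p.2, maximalGeodesic cov p.proj p.2 t = q} with hsw
  set R : Set M := ⋃ k : ℕ, sw^[k] {x₀} with hR
  have hstep : ∀ (k : ℕ) (a b : M), a ∈ sw^[k] {x₀} →
      (∃ p : TangentBundle I M, p.proj = a ∧
        ∃ t ∈ maximalGeodesicDomain cov p.proj p.2, maximalGeodesic cov p.proj p.2 t = b) →
      b ∈ sw^[k + 1] {x₀} := by
    intro k a b ha ⟨p, hpa, t, ht, hb⟩
    rw [Function.iterate_succ_apply']
    exact ⟨p, hpa ▸ ha, t, ht, hb⟩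
  have hopen : IsOpen R := by
    refine isOpen_iff_mem_nhds.2 fun a ha ↦ ?_
    obtain ⟨k, hk⟩ := mem_iUnion.1 ha
    obtain ⟨V, hV, hVr⟩ := exists_nhds_geodesic_reach (cov := cov) a
    refine mem_of_superset hV fun b hb ↦ mem_iUnion.2 ⟨k + 1, hstep k a b hk (hVr b hb).1⟩
  have hclosed : IsClosed R := by
    refine isClosed_iff_frequently.2 fun a ha ↦ ?_
    obtain ⟨V, hV, hVr⟩ := exists_nhds_geodesic_reach (cov := cov) a
    obtain ⟨b, hbV, hbR⟩ := (ha.and_eventually hV).exists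
    obtain ⟨k, hk⟩ := mem_iUnion.1 hbV
    exact mem_iUnion.2 ⟨k + 1, hstep k b a hk (hVr b hbR).2⟩
  have hne : R.Nonempty := ⟨x₀, mem_iUnion.2 ⟨0, by simp⟩⟩
  have huniv : R = univ := IsClopen.eq_univ ⟨hclosed, hopen⟩ hne
  have hq : q ∈ R := by rw [huniv]; exact mem_univ q
  exact mem_iUnion.1 hq

/-! ### The theorems -/

/-- **A connected Hausdorff manifold with a `C¹` connection is Lindelöf** (Geroch 1968, Appendix;
Marathe 1972): by induction on `k` the `k`-fold geodesic sweep of `{x₀}` lies in a countable union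
of sweeps of chart domains (Lindelöf by `isLindelof_geodesicSweep_chartSource`; a Lindelöf set is
covered by countably many chart domains), and these sweeps exhaust `M`
(`mem_iUnion_iterate_geodesicSweep`). [cite: Geroch1968JMP, Appendix] -/
theorem isLindelof_univ_of_covariantDerivative [SecondCountableTopology H] [PreconnectedSpace M]
    (cov : CovariantDerivative I E (TangentSpace I : M → Type _))
    [CovariantDerivative.ContMDiffCovariantDerivative cov 1] :
    IsLindelof (univ : Set M) := by
  rcases isEmpty_or_nonempty M with hM | ⟨⟨x₀⟩⟩
  · exact (Set.eq_empty_of_isEmpty (univ : Set M)).symm ▸ isLindelof_empty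
  set sw : Set M → Set M := fun A ↦ {q : M | ∃ p : TangentBundle I M, p.proj ∈ A ∧
      ∃ t ∈ maximalGeodesicDomain cov p.proj p.2, maximalGeodesic cov p.proj p.2 t = q} with hsw
  have hmono : ∀ A B : Set M, A ⊆ B → sw A ⊆ sw B :=
    fun A B hAB q ⟨p, hp, t, ht, hq⟩ ↦ ⟨p, hAB hp, t, ht, hq⟩
  -- every Lindelöf set has a Lindelöf superset of its sweep
  have hsweep : ∀ A : Set M, IsLindelof A → ∃ L : Set M, IsLindelof L ∧ sw A ⊆ L := by
    intro A hA
    obtain ⟨T, hTc, -, hAT⟩ := hA.elim_nhds_subcover (fun x ↦ (chartAt H x).source)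
      fun x _ ↦ (chartAt H x).open_source.mem_nhds (mem_chart_source H x)
    refine ⟨⋃ x ∈ T, sw (chartAt H x).source,
      hTc.isLindelof_biUnion fun x _ ↦ isLindelof_geodesicSweep_chartSource cov x, ?_⟩
    rintro q ⟨p, hp, t, ht, hq⟩
    obtain ⟨x, hxT, hpx⟩ := mem_iUnion₂.1 (hAT hp)
    exact mem_iUnion₂.2 ⟨x, hxT, p, hpx, t, ht, hq⟩
  have hiter : ∀ k : ℕ, ∃ L : Set M, IsLindelof L ∧ sw^[k] {x₀} ⊆ L := by
    intro k
    induction k with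
    | zero => exact ⟨{x₀}, isLindelof_singleton, by simp⟩
    | succ k ih =>
      obtain ⟨L, hL, hkL⟩ := ih
      obtain ⟨L', hL', hLL'⟩ := hsweep L hL
      refine ⟨L', hL', ?_⟩
      rw [Function.iterate_succ_apply']
      exact (hmono _ _ hkL).trans hLL'
  choose L hL hswL using hiter
  have hcov : (univ : Set M) = ⋃ k, L k := by
    refine (eq_univ_of_forall fun q ↦ ?_).symm
    obtain ⟨k, hk⟩ := mem_iUnion_iterate_geodesicSweep cov x₀ q
    exact mem_iUnion.2 ⟨k, hswL k hk⟩
  rw [hcov]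
  exact isLindelof_iUnion hL

/-- **Geroch 1968 / Marathe 1972: a connected Hausdorff manifold carrying a `C¹` affine connection
is σ-compact** (Lindelöf by `isLindelof_univ_of_covariantDerivative`, locally compact by the
charts). [cite: Geroch1968JMP, Appendix] -/
theorem sigmaCompactSpace_of_covariantDerivative [SecondCountableTopology H] [LocallyCompactSpace H]
    [PreconnectedSpace M] (cov : CovariantDerivative I E (TangentSpace I : M → Type _))
    [CovariantDerivative.ContMDiffCovariantDerivative cov 1] : SigmaCompactSpace M := by
  haveI : LindelofSpace M := isLindelof_univ_iff.1 (isLindelof_univ_of_covariantDerivative cov)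
  haveI : LocallyCompactSpace M := ChartedSpace.locallyCompactSpace H M
  exact sigmaCompactSpace_of_lindelof M

/-- **Geroch 1968 / Marathe 1972: a connected Hausdorff manifold carrying a `C¹` affine connection
is second countable** — in particular every connected Hausdorff manifold with a `C^∞` (indeed `C²`)
pseudo-Riemannian, e.g. Lorentzian, metric is second countable, with no time orientation needed
("M̃ is second countable since it carries a Lorentzian metric": Choquet-Bruhat–Geroch 1969, proof
of Thm. 3; Sbierski 2016, §3.3). [cite: Geroch1968JMP, Appendix] [cite: Sbierski2016AHP, §3.3] -/
theorem secondCountableTopology_of_covariantDerivative [SecondCountableTopology H]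
    [LocallyCompactSpace H] [PreconnectedSpace M]
    (cov : CovariantDerivative I E (TangentSpace I : M → Type _))
    [CovariantDerivative.ContMDiffCovariantDerivative cov 1] : SecondCountableTopology M := by
  haveI := sigmaCompactSpace_of_covariantDerivative cov
  exact ChartedSpace.secondCountable_of_sigmaCompact H M

/-! ### Metric forms -/

/-- **A connected Hausdorff manifold carrying a `C^n` pseudo-Riemannian metric, `n ≥ 2`, is second
countable** (Geroch 1968; Marathe 1972): its Levi-Civita connection exists (`hasLeviCivita`) and is
`C¹` (`isLocallyContMDiff_leviCivita_holds`), so `secondCountableTopology_of_covariantDerivative`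
applies. [cite: Geroch1968JMP, Appendix] -/
theorem _root_.Literature.Geometry.Lorentzian.PseudoRiemannianMetric.secondCountableTopology_of_two_le
    [SecondCountableTopology H] [LocallyCompactSpace H] [PreconnectedSpace M] {n : ℕ∞ω}
    (g : PseudoRiemannianMetric I n E (TangentSpace I : M → Type _)) (hn : 2 ≤ n) :
    SecondCountableTopology M := by
  haveI : Fact (1 ≤ n) := ⟨le_trans (by norm_num) hn⟩
  haveI := g.hasLeviCivita
  haveI : CovariantDerivative.ContMDiffCovariantDerivative g.leviCivita 1 :=
    ⟨g.isLocallyContMDiff_leviCivita_holds 1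
      (by rw [show ((1 : ℕ∞) : ℕ∞ω) + 1 = 2 by norm_num]; exact hn) univ isOpen_univ⟩
  exact secondCountableTopology_of_covariantDerivative g.leviCivita

/-- The σ-compact form: a connected Hausdorff manifold carrying a `C^n` pseudo-Riemannian metric,
`n ≥ 2`, is σ-compact. [cite: Geroch1968JMP, Appendix] -/
theorem _root_.Literature.Geometry.Lorentzian.PseudoRiemannianMetric.sigmaCompactSpace_of_two_le
    [SecondCountableTopology H] [LocallyCompactSpace H] [PreconnectedSpace M] {n : ℕ∞ω}
    (g : PseudoRiemannianMetric I n E (TangentSpace I : M → Type _)) (hn : 2 ≤ n) :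
    SigmaCompactSpace M := by
  haveI : Fact (1 ≤ n) := ⟨le_trans (by norm_num) hn⟩
  haveI := g.hasLeviCivita
  haveI : CovariantDerivative.ContMDiffCovariantDerivative g.leviCivita 1 :=
    ⟨g.isLocallyContMDiff_leviCivita_holds 1
      (by rw [show ((1 : ℕ∞) : ℕ∞ω) + 1 = 2 by norm_num]; exact hn) univ isOpen_univ⟩
  exact sigmaCompactSpace_of_covariantDerivative g.leviCivita

/-- **Geroch 1968: every connected Hausdorff `C^∞` manifold modelled on `ℝᵈ` carrying a smooth
Lorentzian metric is second countable** — no time orientation is needed; the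
`secondCountableTopology` field of `LorentzianManifold` / `Spacetime` is implied by the other
fields. This is the countability step of the union of a chain of developments
(Choquet-Bruhat–Geroch 1969, proof of Thm. 3) and of the glued development of Sbierski 2016, §3.3.
[cite: Geroch1968JMP, Appendix] [cite: Sbierski2016AHP, §3.3] -/
theorem _root_.Literature.Geometry.Lorentzian.LorentzianMetric.secondCountableTopology_euclidean
    {d : ℕ} {M : Type*} [TopologicalSpace M] [ChartedSpace (EuclideanSpace ℝ (Fin d)) M]
    [IsManifold (𝓡 d) ∞ M] [T2Space M] [PreconnectedSpace M] (g : LorentzianMetric (𝓡 d) ∞ M) :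
    SecondCountableTopology M :=
  g.toPseudoRiemannianMetric.secondCountableTopology_of_two_le (by simpa using (WithTop.coe_le_coe.2 le_top : ((2 : ℕ∞) : ℕ∞ω) ≤ ∞))

/-- The σ-compact form of the previous statement. [cite: Geroch1968JMP, Appendix] -/
theorem _root_.Literature.Geometry.Lorentzian.LorentzianMetric.sigmaCompactSpace_euclidean
    {d : ℕ} {M : Type*} [TopologicalSpace M] [ChartedSpace (EuclideanSpace ℝ (Fin d)) M]
    [IsManifold (𝓡 d) ∞ M] [T2Space M] [PreconnectedSpace M] (g : LorentzianMetric (𝓡 d) ∞ M) :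
    SigmaCompactSpace M :=
  g.toPseudoRiemannianMetric.sigmaCompactSpace_of_two_le (by simpa using (WithTop.coe_le_coe.2 le_top : ((2 : ℕ∞) : ℕ∞ω) ≤ ∞))

end Literature.Geometry.Manifold

end
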